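/-
Copyright (c) 2026. All rights reserved.
Released under Apache 2.0 license as described in the file LICENSE.
-/
import Literature.AlgebraicGeometry.CossartPiltant200819.GaloisApproximationResidue2008
import Mathlib.GroupTheory.FiniteAbelian.Duality
import Mathlib.RingTheory.Ideal.Cotangent
import HarnessLib

/-!
# Cossart–Piltant 2008, Proposition 6.2 (2), second clause: the diagonal action (28)–(30)

[CossartPiltant2008] Prop. 6.2 (2), HAL hal-00139124 p. 17 l. 58–59 (journal J. Algebra 320
(2008), Prop. 6.2), VERBATIM: "(2) Let `Rʳ := R̃^{G_r(W/V)}`. Then `κ(Rʳ) = κ(Rⁱ)` (27), and the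
action of `H := G_i(W/V)/G_r(W/V)` on `Rʳ` is induced by a diagonal `κ(Rⁱ)`-linear action on
`R̂ʳ ≃ κ(Rⁱ)[[x₁, …, xₙ]]/I`." The printed proof of the second clause (HAL p. 18 l. 39–56, p. 19
l. 1–19): "(28) `ρ : H → GL(m_{Rʳ}/m²_{Rʳ})`, `h ↦ (x̄ ↦ h.x̄)` … By (8), `κ(W)` contains the group
`μ_ε` of `ε`th-roots of unity, where `ε` is the exponent of the Abelian group `H`, and `ε` is
prime to `p` … it can be assumed that `μ_ε ⊆ κ(Rⁱ)` after possibly changing `R₀`. Now, any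
irreducible representation of `H` over `κ(Rⁱ)` has degree one, since `H` is Abelian and
`μ_ε ⊆ κ(Rⁱ)`. Therefore, `ρ` is diagonal up to choosing a basis `(x̄₁, …, x̄ₙ)` of
`m_{Rʳ}/m²_{Rʳ}`. We write `ρ(h).x̄_j =: χ_j(h) x̄_j` … `χ_j ∈ Hom(H, κ(Rⁱ)^×)`. … (29)
`y_j := |H|⁻¹ Σ_{h ∈ H} χ_j(h⁻¹)(h.x_j) ∈ R̂ʳ`. It is immediately checked that `ȳ_j = x̄_j` and that
`h.y_j = χ_j(h) y_j` for each `h ∈ H`. After replacing `x_j` with `y_j`, it can therefore be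
assumed that (30) `h.x_j = χ_i(h) x_j` [sic: the printed display (30), HAL p. 19 l. 16, has
the index `i` for `j`; read `χ_j(h) x_j`] for each `h ∈ H` and `1 ≤ j ≤ n`, i.e. the action is
diagonal on `R̂ʳ`."

The first clause (27) is `exists_mem_fixedPoints_inertiaGroup_sub_lt` /
`residue_image_fixedPoints_eq` and the identities behind (29)–(30) are `apply_sum_twisted_eq_smul`,
`apply_twistedAverage_eq_smul`, `map_twistedAverage_eq` (`GaloisApproximationResidue2008.lean`).
This file PROVES the second clause at FINITE LEVEL, i.e. as the two pieces of algebra the printed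
argument consists of, stated over an arbitrary field `κ` (resp. `k₀`) containing `μ_ε`:

* **(28), PROVED** — `span_eigenvectors_eq_top`, `exists_basis_eigenvectors`: for a finite
  Abelian group `H` and a field `κ` with `HasEnoughRootsOfUnity κ (Monoid.exponent H)` ("`μ_ε ⊆ κ`";
  this forces `|H| ≠ 0` in `κ`, `natCast_card_ne_zero_of_hasEnoughRootsOfUnity`, which is the
  printed "`ε` is prime to `p`"), every `κ`-linear representation `ρ : H →* End_κ V` (any `V`, no
  finiteness) is diagonal: `V` is spanned by simultaneous eigenvectors, hence has a basis of
  vectors `v` with `ρ(h) v = χ(h) v`, `χ ∈ Hom(H, κ^×)`. ROUTE: the isotypic decomposition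
  `x = |H|⁻¹ Σ_{χ ∈ Ĥ} Σ_{h ∈ H} χ(h⁻¹) ρ(h) x` (`sum_sum_twisted_eq_card_smul`) from the character
  relations `Σ_χ χ(a) = 0` for `a ≠ 1` and `|Ĥ| = |H|` (`sum_monoidHom_apply_eq_zero`,
  `sum_monoidHom_apply_one`; Mathlib's duality for finite Abelian groups,
  `CommGroup.exists_apply_ne_one_of_hasEnoughRootsOfUnity`,
  `CommGroup.card_monoidHom_of_hasEnoughRootsOfUnity`), each summand being a `χ`-eigenvector by
  `apply_sum_twisted_eq_smul` — the printed "any irreducible representation of `H` over `κ(Rⁱ)` has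
  degree one, since `H` is Abelian and `μ_ε ⊆ κ(Rⁱ)`" made explicit.
* **(29)–(30) at finite level, PROVED** — `maximalIdeal_span_eigenvectors_eq_top`,
  `exists_eigenvectors_cotangent_basis`, `exists_eigenvectors_span_maximalIdeal`: let `S` be a
  local `k₀`-algebra on which the finite Abelian group `H` acts by ring automorphisms commuting
  with `k₀` (`MulSemiringAction H S`, `SMulCommClass H k₀ S`), `μ_ε ⊆ k₀`. Then the maximal ideal
  `m_S` is generated by `H`-EIGENVECTORS `y ∈ m_S`, `h.y = χ(h) y` (`χ ∈ Hom(H, k₀^×)`); there are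
  eigenvectors `y_j ∈ m_S` whose initial forms `ȳ_j` form a `κ(S)`-basis of `m_S/m_S²`; and if `S`
  is Noetherian, finitely many eigenvectors `y₁, …, yₙ` with `κ(S)`-linearly independent initial
  forms generate `m_S` (a minimal system of generators — a regular system of parameters when `S`
  is regular — on which "the action is diagonal", (30)). ROUTE: the printed one — the elements
  `y = Σ_h χ(h⁻¹) h.x` of (29) are eigenvectors IN `S` (`smul_sum_twisted`), lie in `m_S` for
  `x ∈ m_S` (`sum_twisted_mem_maximalIdeal`; `m_S` is `H`-stable, `smul_mem_maximalIdeal_iff`),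
  and `x = |H|⁻¹ Σ_χ y_χ`; then Nakayama (`IsLocalRing.CotangentSpace.span_image_eq_top_iff`).
  Because the averaging is done in `S` itself rather than in `m/m²` followed by a lift, the
  eigenvector equations hold exactly and no completion is needed.

READING (what is and is not the printed statement). The printed second clause is about the
completion `R̂ʳ` with a field of representatives `κ(Rⁱ) ⊂ R̂ⁱ ⊆ R̂ʳ` through which the
`κ(Rⁱ)^×`-valued characters act; the tree has no dictionary for `R̂ʳ ≃ κ(Rⁱ)[[x₁,…,xₙ]]/I`, for
the coefficient field, or for "`μ_ε ⊆ κ(Rⁱ)` after possibly changing `R₀`", and these remain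
UNTYPED. The theorems below are the finite-level surrogate that the paper's only consumer of the
clause actually uses — the proof of Lemma 9.4 (HAL p. 30: "By proposition 6.2 (2), `G` acts
diagonally on `Ŝ` w.r.t. a suitable r.s.p. `(u₁, u₂, u₃)`: `g.u_j = ζ^{a_j} u_j`", typed as the
named statement `TamePrimeDescentViaStableModel` in `TameDescent2008.lean`, unaffected by this
file): there `[L : K] = l` is a prime `≠ p` and `ζ_l ∈ S`, so `ζ_l ∈ K` (`[K(ζ_l) : K]` divides
both `l − 1` and `l`), `G = Gal(L/K)` acts `k(ζ_l)`-linearly, and the hypotheses below hold with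
`k₀ = k(ζ_l)`, `H = G`. In Prop. 6.2 itself the characters are `κ(Rⁱ)^×`-valued and need NOT lift
multiplicatively to `Rⁱ` before completion; this is exactly why the print completes, and why the
finite-level statement asks for `μ_ε ⊆ k₀ ⊆ S` instead.

AI-written reading aid; nothing here has been reviewed by the authors or by an expert.

## Sources
- [CossartPiltant2008] V. Cossart, O. Piltant, Resolution of singularities of threefolds in
  positive characteristic I, J. Algebra 320 (2008) 1051–1082; HAL hal-00139124v1: Prop 6.2 (2) and
  its proof (HAL p. 17 l. 58–59, p. 18 l. 39–56, p. 19 l. 1–19, (28)–(30)); §3.2 (8) (p. 6);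
  proof of Lemma 9.4 (p. 30).
- [Serre1977] J.-P. Serre, Linear representations of finite groups, GTM 42, Springer 1977, §3.1
  (Abelian groups: irreducible representations of degree one) — folklore background for (28).
-/

noncomputable section

namespace Literature.AlgebraicGeometry.CossartPiltant200819.CP2008

open IsLocalRing

universe u

/-! ### Character relations for a finite Abelian group over a field containing `μ_ε` -/

section Characters

variable {κ : Type*} [Field κ] {H : Type*} [CommGroup H] [Fintype H]
  [HasEnoughRootsOfUnity κ (Monoid.exponent H)]

/-- **"`ε` is prime to `p`" ⇒ `|H|` is invertible**: if the field `κ` contains a primitive `ε`-th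
root of unity, `ε` the exponent of the finite group `H`, then `|H| ≠ 0` in `κ` (`ε` and `|H|` have
the same prime divisors, by Cauchy's theorem). [folklore] -/
theorem natCast_card_ne_zero_of_hasEnoughRootsOfUnity : (Fintype.card H : κ) ≠ 0 := by
  obtain ⟨ζ, hζ⟩ := HasEnoughRootsOfUnity.exists_primitiveRoot κ (Monoid.exponent H)
  haveI : NeZero (Monoid.exponent H) := ⟨Monoid.exponent_ne_zero_of_finite⟩
  have hne : NeZero ((Monoid.exponent H : ℕ) : κ) := hζ.neZero'
  intro h0
  have hp : ringChar κ ∣ Fintype.card H := (ringChar.spec κ _).mp h0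
  rcases CharP.char_is_prime_or_zero κ (ringChar κ) with hprime | hzero
  · haveI : Fact (ringChar κ).Prime := ⟨hprime⟩
    obtain ⟨g, hg⟩ := exists_prime_orderOf_dvd_card (ringChar κ) hp
    have hdvd : ringChar κ ∣ Monoid.exponent H := hg ▸ Monoid.order_dvd_exponent g
    exact hne.out ((ringChar.spec κ _).mpr hdvd)
  · rw [hzero, zero_dvd_iff] at hp
    exact Fintype.card_ne_zero hp

/-- **Orthogonality of characters, first kind**: `Σ_{χ ∈ Hom(H, κ^×)} χ(a) = 0` for `a ≠ 1`
(characters separate points since `μ_ε ⊆ κ`; multiply the sum by a `χ₀` with `χ₀(a) ≠ 1`).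
[folklore] -/
theorem sum_monoidHom_apply_eq_zero [Fintype (H →* κˣ)] {a : H} (ha : a ≠ 1) :
    ∑ φ : H →* κˣ, ((φ a : κˣ) : κ) = 0 := by
  obtain ⟨ψ, hψ⟩ := CommGroup.exists_apply_ne_one_of_hasEnoughRootsOfUnity H κ ha
  have hmul : ((ψ a : κˣ) : κ) * ∑ φ : H →* κˣ, ((φ a : κˣ) : κ) =
      ∑ φ : H →* κˣ, ((φ a : κˣ) : κ) := by
    rw [Finset.mul_sum]
    exact Fintype.sum_equiv (Equiv.mulLeft ψ) _ _ fun φ => by simp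
  have h1 : ((ψ a : κˣ) : κ) ≠ 1 := fun h => hψ (Units.val_eq_one.mp h)
  have h0 : (((ψ a : κˣ) : κ) - 1) * ∑ φ : H →* κˣ, ((φ a : κˣ) : κ) = 0 := by
    rw [sub_mul, one_mul, hmul, sub_self]
  rcases mul_eq_zero.mp h0 with h | h
  · exact absurd (sub_eq_zero.mp h) h1
  · exact h

/-- `Σ_{χ ∈ Hom(H, κ^×)} χ(1) = |Ĥ| = |H|` (`μ_ε ⊆ κ`: `Ĥ ≃ H` noncanonically). [folklore] -/
theorem sum_monoidHom_apply_one [Fintype (H →* κˣ)] :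
    ∑ φ : H →* κˣ, ((φ (1 : H) : κˣ) : κ) = (Fintype.card H : κ) := by
  simp only [map_one, Units.val_one, Finset.sum_const, Finset.card_univ, nsmul_eq_mul, mul_one]
  congr 1
  rw [Fintype.card_eq_nat_card, Fintype.card_eq_nat_card]
  exact CommGroup.card_monoidHom_of_hasEnoughRootsOfUnity H κ

end Characters

/-! ### (28): representations of `H` over `κ ⊇ μ_ε` are diagonal -/

section Diagonal

variable {κ : Type*} [Field κ] {H : Type*} [CommGroup H] [Fintype H]
  [HasEnoughRootsOfUnity κ (Monoid.exponent H)]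
  {V : Type*} [AddCommGroup V] [Module κ V]

/-- **Isotypic decomposition**: `Σ_{χ ∈ Ĥ} Σ_{h ∈ H} χ(h⁻¹) ρ(h) x = |H| · x` — the sum of the
(unnormalised) twisted averages (29) over all characters recovers `|H| x`. [folklore] -/
theorem sum_sum_twisted_eq_card_smul [Fintype (H →* κˣ)] (ρ : H →* Module.End κ V) (x : V) :
    ∑ φ : H →* κˣ, ∑ h : H, ((φ h⁻¹ : κˣ) : κ) • ρ h x = (Fintype.card H : κ) • x := by
  classical
  rw [Finset.sum_comm]
  simp_rw [← Finset.sum_smul]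
  rw [Finset.sum_eq_single (1 : H)]
  · rw [inv_one, sum_monoidHom_apply_one, map_one, Module.End.one_apply]
  · intro h _ hne
    rw [sum_monoidHom_apply_eq_zero (inv_ne_one.mpr hne), zero_smul]
  · intro h
    exact absurd (Finset.mem_univ _) h

/-- Every vector is a `κ`-linear combination of simultaneous `H`-eigenvectors:
`x = |H|⁻¹ Σ_χ y_χ` with `ρ(g) y_χ = χ(g) y_χ`. [folklore] -/
theorem mem_span_eigenvectors (ρ : H →* Module.End κ V) (x : V) :
    x ∈ Submodule.span κ {v : V | ∃ φ : H →* κˣ, ∀ h : H, ρ h v = ((φ h : κˣ) : κ) • v} := by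
  classical
  letI : Fintype (H →* κˣ) := Fintype.ofFinite _
  have hH : (Fintype.card H : κ) ≠ 0 := natCast_card_ne_zero_of_hasEnoughRootsOfUnity
  have hx : x = (Fintype.card H : κ)⁻¹ •
      ∑ φ : H →* κˣ, ∑ h : H, ((φ h⁻¹ : κˣ) : κ) • ρ h x := by
    rw [sum_sum_twisted_eq_card_smul, smul_smul, inv_mul_cancel₀ hH, one_smul]
  rw [hx]
  refine Submodule.smul_mem _ _ (Submodule.sum_mem _ fun φ _ =>
    Submodule.subset_span ⟨φ, fun g => ?_⟩)
  have key := apply_sum_twisted_eq_smul ρ ((Units.coeHom κ).comp φ) x g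
  simpa using key

/-- **Cossart–Piltant 2008, Prop 6.2 (2), (28) — PROVED (finite Abelian `H`, `μ_ε ⊆ κ`)**: "any
irreducible representation of `H` over `κ(Rⁱ)` has degree one, since `H` is Abelian and
`μ_ε ⊆ κ(Rⁱ)`": the simultaneous eigenvectors of any `κ`-linear representation of `H` span.
[cite: CossartPiltant2008, Prop 6.2 (2), (28) (HAL p. 18 l. 53–56)] -/
theorem span_eigenvectors_eq_top (ρ : H →* Module.End κ V) :
    Submodule.span κ {v : V | ∃ φ : H →* κˣ, ∀ h : H, ρ h v = ((φ h : κˣ) : κ) • v} = ⊤ :=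
  Submodule.eq_top_iff'.mpr fun x => mem_span_eigenvectors ρ x

/-- **Cossart–Piltant 2008, Prop 6.2 (2), (28) — PROVED**: "Therefore, `ρ` is diagonal up to
choosing a basis `(x̄₁, …, x̄ₙ)` … `ρ(h).x̄_j = χ_j(h) x̄_j`, `χ_j ∈ Hom(H, κ(Rⁱ)^×)`": every
`κ`-linear representation of the finite Abelian group `H`, `μ_ε ⊆ κ`, admits a basis of
simultaneous eigenvectors with `κ^×`-valued characters.
[cite: CossartPiltant2008, Prop 6.2 (2), (28) (HAL p. 18 l. 53–56)] -/
theorem exists_basis_eigenvectors (ρ : H →* Module.End κ V) :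
    ∃ (s : Set V) (b : Module.Basis s κ V), (∀ i, b i = (i : V)) ∧
      ∀ v ∈ s, ∃ φ : H →* κˣ, ∀ h : H, ρ h v = ((φ h : κˣ) : κ) • v := by
  obtain ⟨s, hsE, hspan, hli⟩ := exists_linearIndependent κ
    {v : V | ∃ φ : H →* κˣ, ∀ h : H, ρ h v = ((φ h : κˣ) : κ) • v}
  rw [span_eigenvectors_eq_top] at hspan
  refine ⟨s, Module.Basis.mk hli (by simp [hspan]), fun i => ?_, fun v hv => hsE hv⟩
  exact Module.Basis.mk_apply hli _ i

end Diagonal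

/-! ### (29)–(30) at finite level: a tame Abelian action on a local `k₀`-algebra is diagonal -/

section LocalRing

variable {k₀ : Type*} [Field k₀] {S : Type u} [CommRing S] [IsLocalRing S] [Algebra k₀ S]
  {H : Type*} [CommGroup H] [Fintype H] [MulSemiringAction H S] [SMulCommClass H k₀ S]

omit [Fintype H] [SMulCommClass H k₀ S] in
/-- Ring automorphisms of a local ring preserve the maximal ideal: `h.a ∈ m_S ↔ a ∈ m_S`.
[folklore] -/
theorem smul_mem_maximalIdeal_iff (h : H) {a : S} :
    h • a ∈ maximalIdeal S ↔ a ∈ maximalIdeal S := by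
  have key : ∀ (g : H) (b : S), IsUnit b → IsUnit (g • b) := fun g b hb =>
    hb.map (MulSemiringAction.toRingHom H S g)
  simp only [IsLocalRing.mem_maximalIdeal, mem_nonunits_iff]
  refine ⟨fun hna ha => hna (key h a ha), fun hna hha => hna ?_⟩
  have := key h⁻¹ (h • a) hha
  rwa [inv_smul_smul] at this

omit [IsLocalRing S] in
/-- **(29) ⇒ (30) in `S`**: the twisted sum `y := Σ_h χ(h⁻¹) h.x` is an `H`-eigenvector,
`g.y = χ(g) y` (an instance of `apply_sum_twisted_eq_smul`).
[cite: CossartPiltant2008, Prop 6.2 (2), (29)-(30) (HAL p. 19 l. 3–19)] -/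
theorem smul_sum_twisted (φ : H →* k₀ˣ) (x : S) (g : H) :
    g • (∑ h : H, ((φ h⁻¹ : k₀ˣ) : k₀) • h • x) =
      ((φ g : k₀ˣ) : k₀) • ∑ h : H, ((φ h⁻¹ : k₀ˣ) : k₀) • h • x := by
  have key := apply_sum_twisted_eq_smul (DistribMulAction.toModuleEnd k₀ S : H →* Module.End k₀ S)
    ((Units.coeHom k₀).comp φ) x g
  simp only [DistribMulAction.toModuleEnd_apply, DistribSMul.toLinearMap_apply, MonoidHom.coe_comp,
    Function.comp_apply, Units.coeHom_apply] at key
  exact key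

omit [SMulCommClass H k₀ S] in
/-- The twisted sum of an element of `m_S` lies in `m_S` (`m_S` is `H`-stable and a
`k₀`-submodule). [folklore] -/
theorem sum_twisted_mem_maximalIdeal (φ : H →* k₀ˣ) {x : S} (hx : x ∈ maximalIdeal S) :
    (∑ h : H, ((φ h⁻¹ : k₀ˣ) : k₀) • h • x) ∈ maximalIdeal S := by
  refine Ideal.sum_mem _ fun h _ => ?_
  rw [Algebra.smul_def]
  exact Ideal.mul_mem_left _ _ ((smul_mem_maximalIdeal_iff h).mpr hx)

variable [HasEnoughRootsOfUnity k₀ (Monoid.exponent H)]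

omit [IsLocalRing S] in
/-- `Σ_χ Σ_h χ(h⁻¹) h.x = |H| · x` in `S` (`sum_sum_twisted_eq_card_smul` for the `k₀`-linear
action of `H` on `S`). [folklore] -/
theorem sum_sum_twisted_eq_card_smul' [Fintype (H →* k₀ˣ)] (x : S) :
    ∑ φ : H →* k₀ˣ, ∑ h : H, ((φ h⁻¹ : k₀ˣ) : k₀) • h • x = (Fintype.card H : k₀) • x := by
  have key := sum_sum_twisted_eq_card_smul
    (DistribMulAction.toModuleEnd k₀ S : H →* Module.End k₀ S) x
  simp only [DistribMulAction.toModuleEnd_apply, DistribSMul.toLinearMap_apply] at key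
  exact key

/-- **Cossart–Piltant 2008, Prop 6.2 (2), (29)–(30) at finite level — PROVED**: for a local
`k₀`-algebra `S` with an action of the finite Abelian group `H` by `k₀`-algebra automorphisms,
`μ_ε ⊆ k₀` (`ε` the exponent of `H`), the maximal ideal `m_S` is generated, as an `S`-module, by
`H`-eigenvectors `y ∈ m_S`, `h.y = χ(h) y` with `χ ∈ Hom(H, k₀^×)`
(`x = |H|⁻¹ Σ_χ Σ_h χ(h⁻¹) h.x` for `x ∈ m_S`).
[cite: CossartPiltant2008, Prop 6.2 (2), (29)-(30) (HAL p. 19 l. 3–19)] -/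
theorem maximalIdeal_span_eigenvectors_eq_top :
    Submodule.span S {y : ↥(maximalIdeal S) | ∃ φ : H →* k₀ˣ, ∀ h : H,
      h • (y : S) = ((φ h : k₀ˣ) : k₀) • (y : S)} = ⊤ := by
  classical
  letI : Fintype (H →* k₀ˣ) := Fintype.ofFinite _
  have hH : (Fintype.card H : k₀) ≠ 0 := natCast_card_ne_zero_of_hasEnoughRootsOfUnity
  refine Submodule.eq_top_iff'.mpr fun x => ?_
  have hy : ∀ φ : H →* k₀ˣ,
      (⟨∑ h : H, ((φ h⁻¹ : k₀ˣ) : k₀) • h • (x : S), sum_twisted_mem_maximalIdeal φ x.2⟩ :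
        ↥(maximalIdeal S)) ∈ Submodule.span S {y : ↥(maximalIdeal S) | ∃ φ : H →* k₀ˣ, ∀ h : H,
          h • (y : S) = ((φ h : k₀ˣ) : k₀) • (y : S)} :=
    fun φ => Submodule.subset_span ⟨φ, fun g => smul_sum_twisted φ (x : S) g⟩
  have hsum := Submodule.smul_mem _ (algebraMap k₀ S ((Fintype.card H : k₀)⁻¹))
    (Submodule.sum_mem _ fun φ (_ : φ ∈ (Finset.univ : Finset (H →* k₀ˣ))) => hy φ)
  convert hsum using 1
  apply Subtype.ext
  rw [Submodule.coe_smul, AddSubmonoidClass.coe_finsetSum]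
  simp only []
  rw [sum_sum_twisted_eq_card_smul', smul_eq_mul, ← Algebra.smul_def, smul_smul,
    inv_mul_cancel₀ hH, one_smul]

/-- **Cossart–Piltant 2008, Prop 6.2 (2), (28)–(30) at finite level — PROVED**: "`ρ` is diagonal
up to choosing a basis `(x̄₁, …, x̄ₙ)` of `m/m²` … After replacing `x_j` with `y_j`, it can be
assumed that `h.x_j = χ_j(h) x_j`": there are `H`-eigenvectors `y_j ∈ m_S`, `h.y_j = χ_j(h) y_j`
(`χ_j ∈ Hom(H, k₀^×)`), whose initial forms `ȳ_j` form a `κ(S)`-basis of `m_S/m_S²`.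
[cite: CossartPiltant2008, Prop 6.2 (2), (28)-(30) (HAL p. 18 l. 53–56, p. 19 l. 3–19)] -/
theorem exists_eigenvectors_cotangent_basis :
    ∃ (ι : Type u) (y : ι → ↥(maximalIdeal S)) (χ : ι → (H →* k₀ˣ)),
      (∀ i (h : H), h • (y i : S) = ((χ i h : k₀ˣ) : k₀) • (y i : S)) ∧
      LinearIndependent (ResidueField S) (fun i => (maximalIdeal S).toCotangent (y i)) ∧
      Submodule.span (ResidueField S)
        (Set.range fun i => (maximalIdeal S).toCotangent (y i)) = ⊤ := by
  classical
  set E := {y : ↥(maximalIdeal S) | ∃ φ : H →* k₀ˣ, ∀ h : H,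
    h • (y : S) = ((φ h : k₀ˣ) : k₀) • (y : S)} with hE
  have hspanS : Submodule.span S ((maximalIdeal S).toCotangent '' E) = ⊤ := by
    rw [← Submodule.map_span, maximalIdeal_span_eigenvectors_eq_top, Submodule.map_top,
      Ideal.toCotangent_range]
  have hspanκ : Submodule.span (ResidueField S) ((maximalIdeal S).toCotangent '' E) = ⊤ := by
    refine Submodule.eq_top_iff'.mpr fun v => ?_
    have hv : v ∈ Submodule.span S ((maximalIdeal S).toCotangent '' E) := by
      rw [hspanS]; exact Submodule.mem_top
    have hle : Submodule.span S ((maximalIdeal S).toCotangent '' E) ≤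
        (Submodule.span (ResidueField S) ((maximalIdeal S).toCotangent '' E)).restrictScalars S :=
      Submodule.span_le_restrictScalars S (ResidueField S) _
    exact hle hv
  obtain ⟨b, hbE, hbspan, hbli⟩ :=
    exists_linearIndependent (ResidueField S) ((maximalIdeal S).toCotangent '' E)
  rw [hspanκ] at hbspan
  have hpre : ∀ v : b, ∃ y : ↥(maximalIdeal S), y ∈ E ∧ (maximalIdeal S).toCotangent y = v :=
    fun v => hbE v.2
  choose y hyE hyv using hpre
  have hχ' : ∀ i : b, ∃ φ : H →* k₀ˣ, ∀ h : H, h • (y i : S) = ((φ h : k₀ˣ) : k₀) • (y i : S) :=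
    fun i => hyE i
  choose χ hχ using hχ'
  have hfun : (fun i : b => (maximalIdeal S).toCotangent (y i)) = ((↑) : b → CotangentSpace S) :=
    funext hyv
  refine ⟨b, y, χ, hχ, ?_, ?_⟩
  · rw [hfun]; exact hbli
  · rw [hfun, Subtype.range_coe, hbspan]

/-- **Cossart–Piltant 2008, Prop 6.2 (2), (30) at finite level, Noetherian case — PROVED**: if
moreover `S` is Noetherian, finitely many `H`-eigenvectors `y₁, …, yₙ ∈ m_S`, `h.y_j = χ_j(h) y_j`,
with `κ(S)`-linearly independent initial forms, GENERATE `m_S` (Nakayama): a minimal system of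
generators of `m_S` on which "the action is diagonal" — a regular system of parameters when `S`
is regular, as used in the proof of Lemma 9.4 (HAL p. 30: "`g.u_j = ζ^{a_j} u_j`").
[cite: CossartPiltant2008, Prop 6.2 (2), (30) (HAL p. 19 l. 13–19); Lemma 9.4, proof (HAL p. 30)] -/
theorem exists_eigenvectors_span_maximalIdeal [IsNoetherianRing S] :
    ∃ (ι : Type u) (_ : Fintype ι) (y : ι → ↥(maximalIdeal S)) (χ : ι → (H →* k₀ˣ)),
      (∀ i (h : H), h • (y i : S) = ((χ i h : k₀ˣ) : k₀) • (y i : S)) ∧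
      LinearIndependent (ResidueField S) (fun i => (maximalIdeal S).toCotangent (y i)) ∧
      Ideal.span (Set.range fun i => (y i : S)) = maximalIdeal S := by
  obtain ⟨ι, y, χ, hχ, hli, hspan⟩ :=
    exists_eigenvectors_cotangent_basis (k₀ := k₀) (S := S) (H := H)
  haveI : Finite ι := hli.finite
  have htop : Submodule.span S (Set.range y) = ⊤ := by
    rw [← IsLocalRing.CotangentSpace.span_image_eq_top_iff, ← Set.range_comp]
    exact hspan
  refine ⟨ι, Fintype.ofFinite ι, y, χ, hχ, hli, ?_⟩
  have hmap := congrArg (Submodule.map (maximalIdeal S).subtype) htop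
  rw [Submodule.map_span, Submodule.map_top, Submodule.range_subtype, ← Set.range_comp] at hmap
  exact hmap

end LocalRing

end Literature.AlgebraicGeometry.CossartPiltant200819.CP2008
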